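import Summits.QuantumFields.YangMills.Theorems.TwistedTraceScaling.Negative.AvgKernelStiffFlipOnSlice
import HarnessLib

/-!
# R33d — no pointwise «slow factor × untwisted stiff factor» model of `K̃_β` even ON THE FADDEEV–POPOV SLICE `T = {gaugeCoordSq = 0}`: the slice flip pair of
# R33c kills every flip-decaying candidate (crux disprover of `TwistedTraceScaling`, stmt-QuantumFields-20203, cycle 26; `--supports` the crux; negative lane, def-free)

R33b (`not_flipDecaying_sandwich(_kinetic)`) refuted the displayed model `K̃_β = 𝒩·K₁^{L³β}(u,u')·G_st(w,w')·(1 ± η)` on all CORE TUBE POINTS; lane A claims the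
display «on `T × T`» only (COARSE-DESIGN §23.2 (3)/§23.7), `T` = the Faddeev–Popov slice `{U : gaugeCoordSq L U = 0}` (`gaugeCoordSq U = ‖P_{gaugeModes}(relLinkVec U)‖²`,
`gaugeModes = range vacGrad`).  R33's antipodal stiff witness has nonzero lattice divergence and is NOT on `T`.  This file closes that loophole: the same
no-go statements with the two EXTRA premises `gaugeCoordSq L (orthoTube L u v) = 0`, `gaugeCoordSq L (orthoTube L u' v') = 0` inside the sandwich, killed by
R33c's PLAQUETTE-LOOP flip pair (`exists_slice_flip_pair`: divergence-free stiff datum ⇒ both tube points on `T`, by lane A's own `basedFn_zero_left`).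
* ★★ `not_flipDecaying_sandwich_slice` — `2 ≤ L`, `0 ≤ s < 1/2`, any candidate `M_β > 0` with flip decay rate `c > 0` over abelian diagonal slow data: NO `η < 1`,
  eventual `𝒩_β > 0` with `(1−η)𝒩_β M_β ≤ K̃_β ≤ (1+η)𝒩_β M_β` on the core points OF THE SLICE (witness amplitude `a = β^{−s}/32`, model loss `e^{−cβ^{1−2s}/256} → 0`).
* ★★ `not_flipDecaying_sandwich_slice_kinetic` — nor with `η_β → 0` on the kinetic core of the slice (`Σ_e|v_e|², Σ_e|v'_e|² ≤ C²/β`, every `C > 0`; `a = C/(4√β)`,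
  fixed loss `e^{−cC²/4} < 1`).
* ★★ `not_slowTimesLab_sandwich_slice(_kinetic)` — the instances `M_β = F_β(u,u')·K_β(U,V)`, `F_β > 0` arbitrary (flip decay rate `c = 4`, R33b `slowTimesLab_flipDecay`).
CLASS: misstated display (as R33b).  REPAIRED MODEL `C′` unchanged: the jointly TWISTED product `∫_{SU(2)} K₁^{L³β}(u, Ad_g u′)·G_st(w, R_g w′) dg`; restricting to the slice
does not remove the residual CONSTANT gauge group (the slice fixes `range vacGrad` only; constant modes are its kernel), so the flip pair lives on `T` and misses `C′` exactly
as before.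
HONEST FRAMING: inequalities about one displayed intermediate formula of lane A's design for stub S-BASE/C4-CORE of a child of the CONDITIONAL reduction route R2b1
(`LuscherReduction`); it does not refute `TwistedTraceScaling`, C4, or any registered statement; not a gap, not Clay.

## References
* M. Lüscher, Some analytic results concerning the mass spectrum of Yang–Mills gauge theories on a torus, Nucl. Phys. B219 (1983) 233–261, §3. [Luscher1983]
* E. Seiler, Gauge Theories as a Problem of Constructive Quantum Field Theory and Statistical Mechanics, LNP 159 (1982), §3. [SeilerLNP1982]
-/

set_option autoImplicit false

noncomputable section

open Real Filter Topology
open Literature.MathematicalPhysics.QuantumFieldTheory hiding SU2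
open Literature.MathematicalPhysics.QuantumLattice

namespace Summit.QuantumFields.YangMills.Theorems.TwistedTraceScaling.Negative.R33d

open Summit.QuantumFields.YangMills.Theorems.FemtoTransferGap
open Summit.QuantumFields.YangMills.Theorems.FemtoTransferGap.TwoLattice.Avg
open Summit.QuantumFields.YangMills.Theorems.FemtoTransferGap.TwoLattice.ConstTube
open Summit.QuantumFields.YangMills.Theorems.TwistedTraceScaling.Negative.R33
open Summit.QuantumFields.YangMills.Theorems.TwistedTraceScaling.Negative.R33b (kinetic_tolerance_aux slowTimesLab_flipDecay)
open Summit.QuantumFields.YangMills.Theorems.TwistedTraceScaling.Negative.R33c (exists_slice_flip_pair)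

variable {L : ℕ} [NeZero L]

/-! ## §1 ★★ No flip-decaying pointwise model of `K̃_β` on the core OF THE SLICE -/

/-- ★★ **No pointwise «slow × untwisted stiff» model of `K̃_β` on the slice core, fixed tolerance.**  `M_β > 0` any candidate with flip decay
`M_β(u_θ,u_θ,v,−v) ≤ e^{−cβΣ|v_e|²} M_β(u_θ,u_θ,v,v)` over abelian diagonal slow data (`c > 0`); for `2 ≤ L`, `0 ≤ s < 1/2` there are NO `η < 1` and eventual
`𝒩_β > 0` sandwiching `K̃_β` by `(1 ± η)𝒩_β M_β` on all core tube points `orthoTube u v`, `orthoTube u' v'` THAT LIE ON THE SLICE `gaugeCoordSq = 0`.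
Witness: R33c's slice flip pair, `a = β^{−s}/32`. [folklore] -/
theorem not_flipDecaying_sandwich_slice (hL : 2 ≤ L) {s : ℝ} (hs0 : 0 ≤ s) (hs : s < 1 / 2) {c : ℝ} (hc : 0 < c)
    {M : ℝ → GaugeConfig 3 1 SU2 → GaugeConfig 3 1 SU2 → (Edge 3 L → Fin 3 → ℝ) → (Edge 3 L → Fin 3 → ℝ) → ℝ}
    (hM0 : ∀ β u u' v v', 0 < M β u u' v v')
    (hM : ∀ (β : ℝ) (θ : Fin 3 → ℝ) (v : Edge 3 L → Fin 3 → ℝ), v ∈ capBalancedSet L → (∀ e, v e 0 = 0) →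
      M β (fun e => diagSU2 (θ e.2)) (fun e => diagSU2 (θ e.2)) v (-v) ≤
        Real.exp (-(c * β * ∑ e, ∑ b, v e b ^ 2)) * M β (fun e => diagSU2 (θ e.2)) (fun e => diagSU2 (θ e.2)) v v) :
    ¬ ∃ η : ℝ, η < 1 ∧ ∃ β₀ : ℝ, ∀ β : ℝ, β₀ ≤ β → ∃ 𝒩 : ℝ, 0 < 𝒩 ∧
        ∀ (u u' : GaugeConfig 3 1 SU2) (v v' : Edge 3 L → Fin 3 → ℝ), v ∈ capBalancedSet L → v' ∈ capBalancedSet L →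
        (∀ e, frobNorm (((u e : SU2) : Matrix (Fin 2) (Fin 2) ℂ) - 1) < powScale s β) →
        (∀ e, frobNorm (((u' e : SU2) : Matrix (Fin 2) (Fin 2) ℂ) - 1) < powScale s β) →
        (∀ e, frobNorm (((orthoTube L u v e : SU2) : Matrix (Fin 2) (Fin 2) ℂ) - 1) < powScale s β) →
        (∀ e, frobNorm (((orthoTube L u' v' e : SU2) : Matrix (Fin 2) (Fin 2) ℂ) - 1) < powScale s β) →
        orbitDist (orthoTube L u v) < powScale s β → orbitDist (orthoTube L u' v') < powScale s β →
        gaugeCoordSq L (orthoTube L u v) = 0 → gaugeCoordSq L (orthoTube L u' v') = 0 →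
        (1 - η) * 𝒩 * M β u u' v v' ≤ avgKernel β (orthoTube L u v) (orthoTube L u' v') ∧
        avgKernel β (orthoTube L u v) (orthoTube L u' v') ≤ (1 + η) * 𝒩 * M β u u' v v' := by
  rintro ⟨η, hη, β₀, hβ₀⟩
  have hq : 0 < 1 - 2 * s := by linarith
  by_cases hη1 : 1 + η ≤ 0
  · -- the upper bound is nonpositive: contradiction on the diagonal of the flip pair at `β₀` itself
    obtain ⟨𝒩, h𝒩, h⟩ := hβ₀ β₀ le_rfl
    have ha0 : 0 < powScale s β₀ / 32 := div_pos (powScale_pos s β₀) (by norm_num)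
    obtain ⟨u, v, hv, -, -, -, -, -, hu, hU, -, hoU, -, hSU, -, -, -, -⟩ := exists_slice_flip_pair (L := L) hL hs0 β₀ ha0 le_rfl
    have hup := (h u u v v hv hv hu hu hU hU hoU hoU hSU hSU).2
    have hpos := avgKernel_pos β₀ (orthoTube L u v) (orthoTube L u v)
    have hP : 0 < 𝒩 * M β₀ u u v v := mul_pos h𝒩 (hM0 _ _ _ _ _)
    nlinarith
  · have hη1 : 0 < 1 + η := lt_of_not_ge hη1
    have hε : 0 < (1 - η) / (1 + η) := div_pos (by linarith) hη1
    set ε : ℝ := (1 - η) / (1 + η) with hεdef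
    -- threshold: `β^{1−2s} ≥ T` with `cT/256 > −log ε`
    set T : ℝ := 256 / c * max (-Real.log ε) 0 + 1 with hT
    have hT0 : 0 < T := by positivity
    obtain ⟨β₁, hβ₁⟩ := rpow_neg_eventually_le hq (inv_pos.mpr hT0)
    set β : ℝ := max β₀ β₁ with hβdef
    obtain ⟨hβ1, hβT⟩ := hβ₁ β (le_max_right _ _)
    have hβ0 : 0 < β := by linarith
    have hδ : powScale s β = β ^ (-s) := powScale_eq hβ1
    have hpow : T ≤ β ^ (1 - 2 * s) := by
      have h := hβT
      rw [Real.rpow_neg hβ0.le] at h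
      rwa [inv_le_inv₀ (Real.rpow_pos_of_pos hβ0 _) hT0] at h
    -- the stiff amplitude `a = β^{−s}/32`: `β·4a² = β^{1−2s}/256`
    set a : ℝ := powScale s β / 32 with hadef
    have ha0 : 0 < a := div_pos (powScale_pos s β) (by norm_num)
    have h2a : β * (4 * a ^ 2) = β ^ (1 - 2 * s) / 256 := by
      rw [hadef, hδ, div_pow, ← Real.rpow_natCast (β ^ (-s)) 2, ← Real.rpow_mul hβ0.le,
        show (1 : ℝ) - 2 * s = 1 + -s * ((2 : ℕ) : ℝ) by push_cast; ring, Real.rpow_add hβ0, Real.rpow_one]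
      ring
    have hexp : Real.exp (-(c * β * (4 * a ^ 2))) < ε := by
      rw [← Real.exp_log hε, Real.exp_lt_exp, show c * β * (4 * a ^ 2) = c * (β * (4 * a ^ 2)) by ring, h2a]
      have h1 : c * (T / 256) ≤ c * (β ^ (1 - 2 * s) / 256) :=
        mul_le_mul_of_nonneg_left (div_le_div_of_nonneg_right hpow (by norm_num)) hc.le
      have h2 : c * (T / 256) = max (-Real.log ε) 0 + c / 256 := by rw [hT]; field_simp
      have h3 := le_max_left (-Real.log ε) 0
      linarith
    obtain ⟨u, v, hv, hnv, hv0, hvv, -, ⟨θ, hθ⟩, hu, hU, hV, hoU, hoV, hSU, hSV, -, hA, -⟩ := exists_slice_flip_pair (L := L) hL hs0 β ha0 le_rfl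
    obtain ⟨𝒩, h𝒩, h⟩ := hβ₀ β (le_max_left _ _)
    have hlow := (h u u v v hv hv hu hu hU hU hoU hoU hSU hSU).1
    have hup := (h u u v (-v) hv hnv hu hu hU hV hoU hoV hSU hSV).2
    rw [hA] at hup
    have hflip := hM β θ v hv hv0
    rw [← hθ, hvv] at hflip
    have hMpos := hM0 β u u v v
    -- `(1−η)𝒩M ≤ K̃(U,U) = K̃(U,V) ≤ (1+η)𝒩M(v,−v) ≤ (1+η)𝒩·e^{−cβ4a²}·M < (1+η)𝒩·ε·M = (1−η)𝒩M`
    have h3 : (1 + η) * 𝒩 * M β u u v (-v) ≤ (1 + η) * 𝒩 * (Real.exp (-(c * β * (4 * a ^ 2))) * M β u u v v) :=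
      mul_le_mul_of_nonneg_left hflip (mul_nonneg hη1.le h𝒩.le)
    have h4 : (1 + η) * 𝒩 * (Real.exp (-(c * β * (4 * a ^ 2))) * M β u u v v) < (1 + η) * 𝒩 * (ε * M β u u v v) :=
      mul_lt_mul_of_pos_left (mul_lt_mul_of_pos_right hexp hMpos) (mul_pos hη1 h𝒩)
    have h5 : (1 + η) * 𝒩 * (ε * M β u u v v) = (1 - η) * 𝒩 * M β u u v v := by
      rw [hεdef]; field_simp
    linarith

/-- ★★ **… NOR ON THE KINETIC CORE OF THE SLICE with `η_β → 0`.**  Same `M_β`; for `2 ≤ L`, `0 ≤ s < 1/2` and every `C > 0` there are NO `η_β → 0` and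
eventual `𝒩_β > 0` with `(1−η_β)𝒩_β M_β ≤ K̃_β ≤ (1+η_β)𝒩_β M_β` for all slice tube points of the core whose stiff data have kinetic-typical size
`Σ_e|v_e|², Σ_e|v'_e|² ≤ C²/β`.  Witness: the slice flip pair with `a = C/(4√β)` (`Σ_e|v_e|² = C²/(4β)`, fixed model loss `e^{−cC²/4} < 1`). [folklore] -/
theorem not_flipDecaying_sandwich_slice_kinetic (hL : 2 ≤ L) {s : ℝ} (hs0 : 0 ≤ s) (hs : s < 1 / 2) {c C : ℝ} (hc : 0 < c) (hC : 0 < C)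
    {M : ℝ → GaugeConfig 3 1 SU2 → GaugeConfig 3 1 SU2 → (Edge 3 L → Fin 3 → ℝ) → (Edge 3 L → Fin 3 → ℝ) → ℝ}
    (hM0 : ∀ β u u' v v', 0 < M β u u' v v')
    (hM : ∀ (β : ℝ) (θ : Fin 3 → ℝ) (v : Edge 3 L → Fin 3 → ℝ), v ∈ capBalancedSet L → (∀ e, v e 0 = 0) →
      M β (fun e => diagSU2 (θ e.2)) (fun e => diagSU2 (θ e.2)) v (-v) ≤
        Real.exp (-(c * β * ∑ e, ∑ b, v e b ^ 2)) * M β (fun e => diagSU2 (θ e.2)) (fun e => diagSU2 (θ e.2)) v v) :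
    ¬ ∃ η : ℝ → ℝ, Tendsto η atTop (𝓝 0) ∧ ∃ β₀ : ℝ, ∀ β : ℝ, β₀ ≤ β → ∃ 𝒩 : ℝ, 0 < 𝒩 ∧
        ∀ (u u' : GaugeConfig 3 1 SU2) (v v' : Edge 3 L → Fin 3 → ℝ), v ∈ capBalancedSet L → v' ∈ capBalancedSet L →
        (∀ e, frobNorm (((u e : SU2) : Matrix (Fin 2) (Fin 2) ℂ) - 1) < powScale s β) →
        (∀ e, frobNorm (((u' e : SU2) : Matrix (Fin 2) (Fin 2) ℂ) - 1) < powScale s β) →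
        (∀ e, frobNorm (((orthoTube L u v e : SU2) : Matrix (Fin 2) (Fin 2) ℂ) - 1) < powScale s β) →
        (∀ e, frobNorm (((orthoTube L u' v' e : SU2) : Matrix (Fin 2) (Fin 2) ℂ) - 1) < powScale s β) →
        orbitDist (orthoTube L u v) < powScale s β → orbitDist (orthoTube L u' v') < powScale s β →
        gaugeCoordSq L (orthoTube L u v) = 0 → gaugeCoordSq L (orthoTube L u' v') = 0 →
        ∑ e, ∑ b, v e b ^ 2 ≤ C ^ 2 / β → ∑ e, ∑ b, v' e b ^ 2 ≤ C ^ 2 / β →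
        (1 - η β) * 𝒩 * M β u u' v v' ≤ avgKernel β (orthoTube L u v) (orthoTube L u' v') ∧
        avgKernel β (orthoTube L u v) (orthoTube L u' v') ≤ (1 + η β) * 𝒩 * M β u u' v v' := by
  rintro ⟨η, hη, β₀, hβ₀⟩
  have hq : 0 < 1 - 2 * s := by linarith
  -- the fixed model loss `E = e^{−cC²/4} < 1` and the tolerance `η₁ = (1 − E)/2`
  set E : ℝ := Real.exp (-(c * (C ^ 2 / 4))) with hE
  have hE0 : 0 < E := Real.exp_pos _
  have hE1 : E < 1 := Real.exp_lt_one_iff.mpr (by have : 0 < c * (C ^ 2 / 4) := (by positivity); linarith)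
  set η₁ : ℝ := (1 - E) / 2 with hη₁
  have hη₁0 : 0 < η₁ := by rw [hη₁]; linarith
  have htol : (1 + η₁) * E ≤ 1 - η₁ := by rw [hη₁]; exact kinetic_tolerance_aux E
  obtain ⟨β₂, hβ₂⟩ := (Metric.tendsto_atTop.mp hη) η₁ hη₁0
  -- threshold: `β^{1−2s} ≥ 64C²`, i.e. the kinetic amplitude `C/(4√β)` is below the core amplitude `β^{−s}/32`
  set T : ℝ := 64 * C ^ 2 with hT
  have hT0 : 0 < T := by positivity
  obtain ⟨β₁, hβ₁⟩ := rpow_neg_eventually_le hq (inv_pos.mpr hT0)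
  set β : ℝ := max β₀ (max β₁ β₂) with hβdef
  obtain ⟨hβ1, hβT⟩ := hβ₁ β ((le_max_left _ _).trans (le_max_right _ _))
  have hβ0 : 0 < β := by linarith
  have hδ : powScale s β = β ^ (-s) := powScale_eq hβ1
  have hpow : T ≤ β ^ (1 - 2 * s) := by
    have h := hβT
    rw [Real.rpow_neg hβ0.le] at h
    rwa [inv_le_inv₀ (Real.rpow_pos_of_pos hβ0 _) hT0] at h
  have hsqβ : Real.sqrt β ^ 2 = β := Real.sq_sqrt hβ0.le
  -- the kinetic amplitude
  set a : ℝ := C / (4 * Real.sqrt β) with hadef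
  have ha0 : 0 < a := by positivity
  have ha2 : a ^ 2 = C ^ 2 / 16 / β := by rw [hadef, div_pow, mul_pow, hsqβ]; field_simp; ring
  have h2a : 4 * a ^ 2 = C ^ 2 / (4 * β) := by rw [ha2]; field_simp; ring
  have hβa : β * (4 * a ^ 2) = C ^ 2 / 4 := by rw [h2a]; field_simp
  have hale : a ≤ powScale s β / 32 := by
    have h0 : 0 ≤ powScale s β / 32 := (div_pos (powScale_pos s β) (by norm_num)).le
    rw [← pow_le_pow_iff_left₀ ha0.le h0 two_ne_zero]
    have h2 : (powScale s β / 32) ^ 2 = β ^ (1 - 2 * s) / 1024 / β := by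
      rw [hδ, div_pow, ← Real.rpow_natCast (β ^ (-s)) 2, ← Real.rpow_mul hβ0.le,
        show (1 : ℝ) - 2 * s = 1 + -s * ((2 : ℕ) : ℝ) by push_cast; ring, Real.rpow_add hβ0, Real.rpow_one]
      field_simp
      ring
    rw [ha2, h2]
    refine div_le_div_of_nonneg_right ?_ hβ0.le
    rw [div_le_div_iff₀ (by positivity) (by positivity)]
    linarith
  have hCβ : C ^ 2 / (4 * β) ≤ C ^ 2 / β := div_le_div_of_nonneg_left (sq_nonneg C) hβ0 (by linarith)
  obtain ⟨u, v, hv, hnv, hv0, hvv, hnvv, ⟨θ, hθ⟩, hu, hU, hV, hoU, hoV, hSU, hSV, -, hA, -⟩ := exists_slice_flip_pair (L := L) hL hs0 β ha0 hale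
  obtain ⟨𝒩, h𝒩, h⟩ := hβ₀ β (le_max_left _ _)
  have hηβ : |η β| < η₁ := by
    have := hβ₂ β ((le_max_right _ _).trans (le_max_right _ _))
    rwa [Real.dist_eq, sub_zero] at this
  have hkin : ∑ e, ∑ b, v e b ^ 2 ≤ C ^ 2 / β := by rw [hvv, h2a]; exact hCβ
  have hkin' : ∑ e, ∑ b, (-v) e b ^ 2 ≤ C ^ 2 / β := by rw [hnvv, h2a]; exact hCβ
  have hlow := (h u u v v hv hv hu hu hU hU hoU hoU hSU hSU hkin hkin).1
  have hup := (h u u v (-v) hv hnv hu hu hU hV hoU hoV hSU hSV hkin hkin').2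
  rw [hA] at hup
  have hflip := hM β θ v hv hv0
  rw [← hθ, hvv, show c * β * (4 * a ^ 2) = c * (β * (4 * a ^ 2)) by ring, hβa] at hflip
  have hMpos := hM0 β u u v v
  have hηle := abs_lt.mp hηβ
  have hη1 : 0 ≤ 1 + η β := by linarith
  -- `(1−η)𝒩M ≤ K̃ ≤ (1+η)𝒩M(v,−v) ≤ (1+η)𝒩·E·M`, so `1 − η ≤ (1 + η)E ≤ (1 + η₁)E ≤ 1 − η₁ < 1 − η`: impossible
  have h1 : (1 + η β) * 𝒩 * M β u u v (-v) ≤ (1 + η β) * 𝒩 * (E * M β u u v v) :=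
    mul_le_mul_of_nonneg_left hflip (mul_nonneg hη1 h𝒩.le)
  have h2 : (1 - η β) * (𝒩 * M β u u v v) ≤ (1 + η β) * E * (𝒩 * M β u u v v) :=
    calc (1 - η β) * (𝒩 * M β u u v v) = (1 - η β) * 𝒩 * M β u u v v := by ring
      _ ≤ (1 + η β) * 𝒩 * (E * M β u u v v) := hlow.trans (hup.trans h1)
      _ = (1 + η β) * E * (𝒩 * M β u u v v) := by ring
  have h3 : 1 - η β ≤ (1 + η β) * E := le_of_mul_le_mul_right h2 (mul_pos h𝒩 hMpos)
  have h4 : (1 + η β) * E ≤ (1 + η₁) * E := mul_le_mul_of_nonneg_right (by linarith) hE0.le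
  linarith

/-! ## §2 The concrete instance ON THE SLICE: arbitrary positive slow reweighting × LAB kernel -/

/-- ★★ **NO SLOW REWEIGHTING makes the LAB kernel a pointwise model of `K̃_β` on the SLICE core**: for `2 ≤ L`, `0 ≤ s < 1/2`, no `η < 1`, eventual
`𝒩_β > 0` and positive `F_β` with `(1−η)𝒩_β F_β(u,u')K_β(U,V) ≤ K̃_β(U,V) ≤ (1+η)𝒩_β F_β(u,u')K_β(U,V)` for all core tube points `U = orthoTube u v`,
`V = orthoTube u' v'` with `gaugeCoordSq U = gaugeCoordSq V = 0`. [folklore] -/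
theorem not_slowTimesLab_sandwich_slice (hL : 2 ≤ L) {s : ℝ} (hs0 : 0 ≤ s) (hs : s < 1 / 2)
    {F : ℝ → GaugeConfig 3 1 SU2 → GaugeConfig 3 1 SU2 → ℝ} (hF0 : ∀ β u u', 0 < F β u u') :
    ¬ ∃ η : ℝ, η < 1 ∧ ∃ β₀ : ℝ, ∀ β : ℝ, β₀ ≤ β → ∃ 𝒩 : ℝ, 0 < 𝒩 ∧
        ∀ (u u' : GaugeConfig 3 1 SU2) (v v' : Edge 3 L → Fin 3 → ℝ), v ∈ capBalancedSet L → v' ∈ capBalancedSet L →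
        (∀ e, frobNorm (((u e : SU2) : Matrix (Fin 2) (Fin 2) ℂ) - 1) < powScale s β) →
        (∀ e, frobNorm (((u' e : SU2) : Matrix (Fin 2) (Fin 2) ℂ) - 1) < powScale s β) →
        (∀ e, frobNorm (((orthoTube L u v e : SU2) : Matrix (Fin 2) (Fin 2) ℂ) - 1) < powScale s β) →
        (∀ e, frobNorm (((orthoTube L u' v' e : SU2) : Matrix (Fin 2) (Fin 2) ℂ) - 1) < powScale s β) →
        orbitDist (orthoTube L u v) < powScale s β → orbitDist (orthoTube L u' v') < powScale s β →
        gaugeCoordSq L (orthoTube L u v) = 0 → gaugeCoordSq L (orthoTube L u' v') = 0 →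
        (1 - η) * 𝒩 * (F β u u' * transferKernel su2Rep β (orthoTube L u v) (orthoTube L u' v')) ≤ avgKernel β (orthoTube L u v) (orthoTube L u' v') ∧
        avgKernel β (orthoTube L u v) (orthoTube L u' v') ≤ (1 + η) * 𝒩 * (F β u u' * transferKernel su2Rep β (orthoTube L u v) (orthoTube L u' v')) :=
  not_flipDecaying_sandwich_slice (L := L) hL hs0 hs (c := 4) (by norm_num)
    (M := fun β u u' v v' => F β u u' * transferKernel su2Rep β (orthoTube L u v) (orthoTube L u' v'))
    (fun β u u' v v' => mul_pos (hF0 β u u') (transferKernel_pos su2Rep β _ _)) (fun β θ v hv hv0 => slowTimesLab_flipDecay β F θ hv hv0)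

/-- ★★ **… nor on the kinetic core of the slice with `η_β → 0`** (stiff data of size `Σ_e|v_e|², Σ_e|v'_e|² ≤ C²/β`, any `C > 0`). [folklore] -/
theorem not_slowTimesLab_sandwich_slice_kinetic (hL : 2 ≤ L) {s : ℝ} (hs0 : 0 ≤ s) (hs : s < 1 / 2) {C : ℝ} (hC : 0 < C)
    {F : ℝ → GaugeConfig 3 1 SU2 → GaugeConfig 3 1 SU2 → ℝ} (hF0 : ∀ β u u', 0 < F β u u') :
    ¬ ∃ η : ℝ → ℝ, Tendsto η atTop (𝓝 0) ∧ ∃ β₀ : ℝ, ∀ β : ℝ, β₀ ≤ β → ∃ 𝒩 : ℝ, 0 < 𝒩 ∧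
        ∀ (u u' : GaugeConfig 3 1 SU2) (v v' : Edge 3 L → Fin 3 → ℝ), v ∈ capBalancedSet L → v' ∈ capBalancedSet L →
        (∀ e, frobNorm (((u e : SU2) : Matrix (Fin 2) (Fin 2) ℂ) - 1) < powScale s β) →
        (∀ e, frobNorm (((u' e : SU2) : Matrix (Fin 2) (Fin 2) ℂ) - 1) < powScale s β) →
        (∀ e, frobNorm (((orthoTube L u v e : SU2) : Matrix (Fin 2) (Fin 2) ℂ) - 1) < powScale s β) →
        (∀ e, frobNorm (((orthoTube L u' v' e : SU2) : Matrix (Fin 2) (Fin 2) ℂ) - 1) < powScale s β) →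
        orbitDist (orthoTube L u v) < powScale s β → orbitDist (orthoTube L u' v') < powScale s β →
        gaugeCoordSq L (orthoTube L u v) = 0 → gaugeCoordSq L (orthoTube L u' v') = 0 →
        ∑ e, ∑ b, v e b ^ 2 ≤ C ^ 2 / β → ∑ e, ∑ b, v' e b ^ 2 ≤ C ^ 2 / β →
        (1 - η β) * 𝒩 * (F β u u' * transferKernel su2Rep β (orthoTube L u v) (orthoTube L u' v')) ≤ avgKernel β (orthoTube L u v) (orthoTube L u' v') ∧
        avgKernel β (orthoTube L u v) (orthoTube L u' v') ≤
          (1 + η β) * 𝒩 * (F β u u' * transferKernel su2Rep β (orthoTube L u v) (orthoTube L u' v')) :=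
  not_flipDecaying_sandwich_slice_kinetic (L := L) hL hs0 hs (c := 4) (by norm_num) hC
    (M := fun β u u' v v' => F β u u' * transferKernel su2Rep β (orthoTube L u v) (orthoTube L u' v'))
    (fun β u u' v v' => mul_pos (hF0 β u u') (transferKernel_pos su2Rep β _ _)) (fun β θ v hv hv0 => slowTimesLab_flipDecay β F θ hv hv0)

end Summit.QuantumFields.YangMills.Theorems.TwistedTraceScaling.Negative.R33d

end
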